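import Summits.AtomisticToContinuum.BoseEinsteinCondensation.Theses.BECStronglyRayleigh
import Literature.Combinatorics.StablePolynomials.Basic

/-!
# Crux-ideate sketches (ideator 3, round 1) for `InsertionFieldDelocalisation`
(stmt-AtomisticToContinuum-9673, route BECStronglyRayleigh).

First lemmas of three idea cards, stated as `Prop`s over existing declarations (no proofs here):

* card `coherence-debiasing-bootstrap`: `PairDeletionDomination` (pure finite double counting +
  Cauchy–Schwarz), `FlatLawSecondMoment` (the transferred crux C⁺) and `DebiasingTransfer`
  (C⁺ + Theorem S + the Lorentzian pair-coherence support ⇒ the crux).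
* card `dyadic-shell-summability`: `ShellLemma` (sub-Gaussian shell deficits with weights
  `a_j ≤ A·2^{-αj}`, `α > 3/2`, have uniformly bounded exponential moments).
* card `squared-amplitude-exchange-herbst`: `DeletionPreservesStability` (`D² = (Σ_x ∂_x)²`
  preserves real stability or kills the polynomial) and the conjecture `SquaredAmplitudeStability`
  (conjecture P of the spine card: `|Ψ₀|²` of the XY torus has a real-stable generating polynomial).
-/

namespace Summit.AtomisticToContinuum.BoseEinsteinCondensation.Cruxes.InsertionFieldDelocalisation.Sketch3

open scoped BigOperators
open Finset
open Literature.MathematicalPhysics.QuantumLattice Literature.Probability.LatticeModels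
open Literature.Combinatorics.StablePolynomials
open Summit.AtomisticToContinuum.BoseEinsteinCondensation.Theses.BECStronglyRayleigh

/-- **Pair-deletion domination** (card A, first lemma; provable now). For any real `φ` supported on
`N`-subsets of a finite set `Λ` (`N ≤ |Λ|`), with the route's insertion field
`r T x = Σ_y [x,y ∉ T, x ≠ y] φ(T ∪ {x,y})`, and any nonnegative test function `F` of the background `T`:
`Σ_{|T|=N-2} ‖r_T‖² F(T) ≤ (|Λ| − N + 1) · Σ_{|S|=N} φ(S)² Σ_{x∈S} Σ_{y∈S∖x} F(S∖{x,y})`.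
Proof: `(r T x)² ≤ (|Λ|−N+1) Σ_y φ(T∪{x,y})²` (Cauchy–Schwarz over the `|Λ|−N+1` admissible `y`),
then re-index `(T,x,y) ↦ S = T ∪ {x,y}` (ordered pairs). It says: the crux's averaging law
`ω_T ∝ ‖r_T‖²` is dominated by `(|Λ|−N+1)·Σφ²·N(N−1)/Σ_T‖r_T‖²` times the PHYSICAL law
"`S ∼ φ²`, delete a uniform ordered pair". -/
def PairDeletionDomination : Prop :=
  ∀ (Λ : Type) [Fintype Λ] [DecidableEq Λ] (N : ℕ), 2 ≤ N → N ≤ Fintype.card Λ →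
    ∀ φ : Finset Λ → ℝ, (∀ S, S.card ≠ N → φ S = 0) → ∀ F : Finset Λ → ℝ, (∀ T, 0 ≤ F T) →
    let r : Finset Λ → Λ → ℝ := fun T x =>
      ∑ y : Λ, (if x ∉ T ∧ y ∉ T ∧ x ≠ y then φ (insert x (insert y T)) else 0)
    ∑ T ∈ (Finset.univ : Finset Λ).powersetCard (N - 2), (∑ x, r T x ^ 2) * F T ≤
      ((Fintype.card Λ : ℝ) - N + 1) *
        ∑ S ∈ (Finset.univ : Finset Λ).powersetCard N,
          φ S ^ 2 * ∑ x ∈ S, ∑ y ∈ S.erase x, F ((S.erase x).erase y)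

/-- **The transferred crux C⁺** (card A): a uniform SECOND moment of the flatness functional
`X_T := L³ Φ_T = L³ (Σ_x r³/(R‖r‖²) + ‖r‖²/R²)` under the physical pair-deleted ground-state law
`P♭` (`S ∼ φ² = |Ψ₀|²`, delete a uniform ordered pair), written cross-multiplied:
`Σ_S φ(S)² Σ_{x∈S,y∈S∖x} X_{S∖{x,y}}² ≤ K · N(N−1) · Σ_S φ(S)²`. No `ω`-weighting, no size bias. -/
def FlatLawSecondMoment : Prop :=
  ∃ K : ℝ, ∀ (L : ℕ) [NeZero L], 2 ≤ L → ∀ N : ℕ, 2 ≤ N → 2 * N ≤ L ^ 3 →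
    ∀ ψ : TensorIndex (TorusSite 3 L) 2 → ℂ,
      ψ ∈ spinZSector 1 ((N : ℝ) - (L : ℝ) ^ 3 / 2) → ψ ≠ 0 →
      (xyTorus 3 L 1).mulVec ψ =
        ((lowestEnergyInSector 1 (xyTorus 3 L 1) ((N : ℝ) - (L : ℝ) ^ 3 / 2) : ℝ) : ℂ) • ψ →
      (∀ σ, 0 ≤ (ψ σ).re ∧ (ψ σ).im = 0) →
      let φ : Finset (TorusSite 3 L) → ℝ := fun S => (ψ (fun x => if x ∈ S then 0 else 1)).re
      let r : Finset (TorusSite 3 L) → TorusSite 3 L → ℝ := fun T x =>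
        ∑ y, (if x ∉ T ∧ y ∉ T ∧ x ≠ y then φ (insert x (insert y T)) else 0)
      let X : Finset (TorusSite 3 L) → ℝ := fun T =>
        (L : ℝ) ^ 3 * ((∑ x, r T x ^ 3) / ((∑ x, r T x) * ∑ x, r T x ^ 2) +
          (∑ x, r T x ^ 2) / (∑ x, r T x) ^ 2)
      ∑ S ∈ (Finset.univ : Finset (TorusSite 3 L)).powersetCard N,
          φ S ^ 2 * ∑ x ∈ S, ∑ y ∈ S.erase x, X ((S.erase x).erase y) ^ 2 ≤
        K * (N : ℝ) * ((N : ℝ) - 1) *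
          ∑ S ∈ (Finset.univ : Finset (TorusSite 3 L)).powersetCard N, φ S ^ 2

/-- **De-biasing transfer** (card A, the line's composition; provable now given its antecedents):
Theorem S (`GroundStateStability`) and the Lorentzian pair-coherence support give
`Σ_T ‖r_T‖² ≥ N(N−1)L³ Σφ² / M_L` with `M_L := E_ω[X]`, whence by `PairDeletionDomination`
`E_ω[F] ≤ M_L · E_{P♭}[F]` for every `F ≥ 0`, and the bootstrap
`M_L ≤ M₀ + E_ω[X; X > M₀] ≤ M₀ + M_L E_{P♭}[X²]/M₀` with `M₀ = 2K` yields `M_L ≤ 4K`. -/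
def DebiasingTransfer : Prop :=
  GroundStateStability → StableImpliesPairCoherence → FlatLawSecondMoment →
    InsertionFieldDelocalisation

/-- **Shell lemma** (card B, first lemma; pure probability on a finite set, provable now by Hölder
over dyadic scales with exponents `p_j ∝ (j+1)²`). If a probability `P` on configurations has
sub-Gaussian DEFICIT tails in a family of neighbourhoods `B_j` of sizes `≤ C₀ 8^j` (3-d dyadic balls)
with variance proxy `κ|B_j|`, then the weighted deficit functional `Σ_j a_j (ν|B_j| − |T ∩ B_j|)₊`
with `a_j ≤ A 2^{−αj}`, `α > 3/2`, has exponential moments bounded uniformly in the configuration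
space, the number of scales and `ν`. The threshold `α > 3/2 = d/2` is where `Σ_j 8^j a_j²` converges;
the Reatto–Chester insertion response has `α = d − 1 = 2`. -/
def ShellLemma : Prop :=
  ∀ (lam A α κ C₀ ν : ℝ), 0 ≤ lam → 0 ≤ A → 0 < κ → 0 ≤ C₀ → 3 / 2 < α →
    ∃ C : ℝ, ∀ (Λ : Type) [Fintype Λ] [DecidableEq Λ] (P : Finset Λ → ℝ),
      (∀ T, 0 ≤ P T) → ∑ T, P T = 1 →
      ∀ (J : ℕ) (B : ℕ → Finset Λ) (a : ℕ → ℝ),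
        (∀ j, ((B j).card : ℝ) ≤ C₀ * 8 ^ j) →
        (∀ j, 0 ≤ a j ∧ a j ≤ A * (2 : ℝ) ^ (-(α * (j : ℝ)))) →
        (∀ (j : ℕ) (s : ℝ), 0 ≤ s →
          ∑ T ∈ (Finset.univ : Finset (Finset Λ)).filter
              (fun T => s ≤ ν * ((B j).card : ℝ) - ((T ∩ B j).card : ℝ)), P T ≤
            2 * Real.exp (-(s ^ 2 / (κ * ((B j).card : ℝ))))) →
        ∑ T, P T * Real.exp (lam * ∑ j ∈ Finset.range J,
            a j * max (ν * ((B j).card : ℝ) - ((T ∩ B j).card : ℝ)) 0) ≤ C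

/-- **Deletion preserves stability** (card C, first lemma; provable now): for a real coefficient
family `q` on subsets of a finite set whose generating polynomial `Σ_S q(S) z^S` is real stable,
the family `(D²q)(T) := Σ_{x ≠ y ∉ T} q(T ∪ {x,y})` — the coefficients of `(Σ_x ∂_x)² Σ_S q(S) z^S`,
i.e. the law "delete a uniform ordered pair" up to normalisation — is identically zero or again
real stable (`D = Σ_x ∂_x` is the derivative along the all-ones direction: the roots `t` of
`p(z + t·1)`, `z ∈ Hⁿ`, have `Im t < 0`, so `p′(z; 1) = p(z) Σ (−1/tᵢ) ≠ 0`). -/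
def DeletionPreservesStability : Prop :=
  ∀ (Λ : Type) [Fintype Λ] [DecidableEq Λ] (q : Finset Λ → ℝ),
    IsRealStable (multiAffine q) →
    let dq : Finset Λ → ℝ := fun T =>
      ∑ x : Λ, ∑ y : Λ, (if x ∉ T ∧ y ∉ T ∧ x ≠ y then q (insert x (insert y T)) else 0)
    (∀ T, dq T = 0) ∨ IsRealStable (multiAffine dq)

/-- **Conjecture P** (card C, load-bearing; the spine card's empirical bonus, ED jobs j000396/j000422:
0 violations on rings, 3×3 … 4×4, 3×3×2, 2×2×4, 3×3×3 tori): for homogeneous pure hopping on a torus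
(`xyTorus d L 1`, any `d ≥ 1`, any sector) the PHYSICAL measure `|Ψ₀|²` of the (Perron-unique)
sector ground vector has a real-stable generating polynomial. In `d = 1` it is the discrete
circular β = 2 ensemble (a theorem). With `DeletionPreservesStability` it makes the pair-deleted
ground-state law `P♭` strongly Rayleigh. -/
def SquaredAmplitudeStability : Prop :=
  ∀ (d L : ℕ) [NeZero L], 1 ≤ d → 2 ≤ L → ∀ N : ℕ, N ≤ L ^ d →
    ∀ ψ : TensorIndex (TorusSite d L) 2 → ℂ,
      ψ ∈ spinZSector 1 ((N : ℝ) - (L : ℝ) ^ d / 2) → ψ ≠ 0 →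
      (xyTorus d L 1).mulVec ψ =
        ((lowestEnergyInSector 1 (xyTorus d L 1) ((N : ℝ) - (L : ℝ) ^ d / 2) : ℝ) : ℂ) • ψ →
      IsRealStable (multiAffine
        (fun S : Finset (TorusSite d L) => Complex.normSq (ψ (fun x => if x ∈ S then 0 else 1))))

end Summit.AtomisticToContinuum.BoseEinsteinCondensation.Cruxes.InsertionFieldDelocalisation.Sketch3
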